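import Literature.Analysis.Distribution.SchwartzParameterIntegral
import Mathlib.MeasureTheory.Integral.IntegralEqImproper
import HarnessLib

/-!
# Superpositions `∫ w(t) Φ(t) dt` of polynomially growing curves in the Schwartz space

Analysis/Distribution support file (everything proved; no definitions, no named facts), sequel
of `SchwartzParameterIntegral`. Let `Φ : ℝ → 𝓢(E, F)` be a continuous curve whose Schwartz
seminorms grow at most polynomially, `p_{k,n}(Φ t) ≤ C (1 + |t|)^N`, and let `w : ℝ → ℝ` be a
continuous weight of rapid decay, `(1 + |t|)^N |w(t)| ≤ C_N`. Then the **superposition**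
`Ψ = ∫_ℝ w(t) Φ(t) dt` exists in `𝓢(E, F)`:

* `SchwartzMap.exists_forall_apply_eq_integral_smul` — there is `Ψ ∈ 𝓢(E, F)` with
  `Ψ(x) = ∫ w(t) Φ(t)(x) dt` for every `x`, and `p_{k,n}(Ψ) ≤ ∫ |w(t)| p_{k,n}(Φ t) dt` for every
  Schwartz seminorm.

Proof: the truncations `Ψ_R = ∫_{-R}^{R}` exist (`SchwartzMap.exists_forall_apply_eq_intervalIntegral`)
and are Cauchy in every seminorm, the difference `Ψ_S - Ψ_R` being the sum of the integrals over
`[R, S]` and `[-S, -R]`, whose seminorms are bounded by the integrable tails of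
`|w| p_{k,n}(Φ ·)` (`SchwartzMap.seminorm_le_intervalIntegral_of_forall_apply_eq_integral`); the
limit in the complete space `𝓢(E, F)` has the asserted pointwise values because point
evaluations are continuous and the scalar truncated integrals converge
(`MeasureTheory.intervalIntegral_tendsto_integral`).

This is the form in which test functions of several points are averaged over the (logarithmic)
time differences with Gaussian-windowed profiles in the Osterwalder–Schrader continuation
(Comm. Math. Phys. 42 (1975), Ch. V–VI); the exchange with a tempered distribution,
`u(Ψ) = ∫ w(t) u(Φ t) dt`, is then the tree's
`SchwartzMap.apply_eq_integral_of_forall_apply_eq_integral` (`SchwartzExchange`). Everything is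
tagged folklore (Rudin, *Functional Analysis*, Thm. 3.27; Hörmander, *ALPDO I*, §5.2).
-/

noncomputable section

open _root_.MeasureTheory Set Filter intervalIntegral Finset
open scoped _root_.Topology SchwartzMap

namespace Literature.Analysis.Distribution

variable {E F : Type*} [NormedAddCommGroup E] [NormedSpace ℝ E] [NormedAddCommGroup F]
  [NormedSpace ℝ F] [CompleteSpace F]

/-- Rapid decay times polynomial growth is integrable: if `(1 + |t|)^M |w t| ≤ D` for all `M` then
`t ↦ |w t| (1 + |t|)^N` is integrable for every `N` (dominate by `D_{N+2} (1 + |t|)^{-2}`). [folklore] -/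
theorem integrable_abs_mul_pow_of_decay {w : ℝ → ℝ} (hwc : Continuous w)
    (hw : ∀ M : ℕ, ∃ D : ℝ, ∀ t, (1 + |t|) ^ M * |w t| ≤ D) (N : ℕ) :
    Integrable fun t : ℝ => |w t| * (1 + |t|) ^ N := by
  obtain ⟨D, hD⟩ := hw (N + 2)
  have hint : Integrable fun t : ℝ => D * (1 + |t|) ^ (-(2 : ℝ)) := by
    refine Integrable.const_mul ?_ D
    have h := integrable_one_add_norm (E := ℝ) (μ := volume) (r := 2) (by simp)
    refine h.congr (Eventually.of_forall fun t => ?_)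
    simp [Real.norm_eq_abs]
  refine hint.mono' ((hwc.abs.mul (by fun_prop)).aestronglyMeasurable)
    (Eventually.of_forall fun t => ?_)
  rw [Real.norm_eq_abs, abs_of_nonneg (by positivity)]
  have h1 : 0 < (1 + |t|) ^ (2 : ℝ) := by positivity
  rw [Real.rpow_neg (by positivity), le_mul_inv_iff₀ h1]
  calc |w t| * (1 + |t|) ^ N * (1 + |t|) ^ (2 : ℝ) = (1 + |t|) ^ (N + 2) * |w t| := by
        rw [show ((2 : ℝ)) = ((2 : ℕ) : ℝ) by norm_num, Real.rpow_natCast, pow_add]; ring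
    _ ≤ D := hD t

/-- **Superposition of a polynomially growing continuous curve in `𝓢(E, F)` with a rapidly
decaying weight**: there is `Ψ ∈ 𝓢(E, F)` with `Ψ(x) = ∫ w(t) Φ(t)(x) dt` for all `x` and
`p_{k,n}(Ψ) ≤ ∫ |w(t)| p_{k,n}(Φ t) dt`. [folklore] -/
theorem _root_.SchwartzMap.exists_forall_apply_eq_integral_smul {Φ : ℝ → 𝓢(E, F)}
    (hΦ : Continuous Φ)
    (hgrowth : ∀ k n : ℕ, ∃ (C : ℝ) (N : ℕ), ∀ t, SchwartzMap.seminorm ℝ k n (Φ t) ≤ C * (1 + |t|) ^ N)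
    {w : ℝ → ℝ} (hwc : Continuous w) (hw : ∀ M : ℕ, ∃ D : ℝ, ∀ t, (1 + |t|) ^ M * |w t| ≤ D) :
    ∃ Ψ : 𝓢(E, F), (∀ x : E, Ψ x = ∫ t, w t • Φ t x) ∧
      ∀ k n : ℕ, SchwartzMap.seminorm ℝ k n Ψ ≤ ∫ t, |w t| * SchwartzMap.seminorm ℝ k n (Φ t) := by
  haveI : CompleteSpace 𝓢(E, F) := Literature.Analysis.FunctionSpaces.completeSpace_schwartzMap
  -- the weighted curve
  set Φw : ℝ → 𝓢(E, F) := fun t => w t • Φ t with hΦw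
  have hΦwc : Continuous Φw := hwc.smul hΦ
  have hsem : ∀ k n t, SchwartzMap.seminorm ℝ k n (Φw t) = |w t| * SchwartzMap.seminorm ℝ k n (Φ t) :=
    fun k n t => by rw [hΦw]; simp only; rw [map_smul_eq_mul, Real.norm_eq_abs]
  -- integrability of the seminorm densities
  have hint : ∀ k n, Integrable fun t => |w t| * SchwartzMap.seminorm ℝ k n (Φ t) := by
    intro k n
    obtain ⟨C, N, hC⟩ := hgrowth k n
    have hC0 : ∀ t, 0 ≤ C * (1 + |t|) ^ N := fun t => (apply_nonneg _ _).trans (hC t)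
    refine ((integrable_abs_mul_pow_of_decay hwc hw N).const_mul |C|).mono' ?_ ?_
    · exact (hwc.abs.mul (((schwartz_withSeminorms ℝ E F).continuous_seminorm (k, n)).comp
        hΦ)).aestronglyMeasurable
    · refine Eventually.of_forall fun t => ?_
      rw [Real.norm_eq_abs, abs_of_nonneg (mul_nonneg (abs_nonneg _) (apply_nonneg _ _))]
      calc |w t| * SchwartzMap.seminorm ℝ k n (Φ t) ≤ |w t| * (C * (1 + |t|) ^ N) :=
            mul_le_mul_of_nonneg_left (hC t) (abs_nonneg _)
        _ ≤ |w t| * (|C| * (1 + |t|) ^ N) := by gcongr; exact le_abs_self C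
        _ = |C| * (|w t| * (1 + |t|) ^ N) := by ring
  -- truncations over `[-R, S]`-type intervals exist
  have hex : ∀ a b : ℝ, a ≤ b → ∃ Ψ : 𝓢(E, F), ∀ x, Ψ x = ∫ t in a..b, Φw t x :=
    fun a b hab => SchwartzMap.exists_forall_apply_eq_intervalIntegral hΦwc hab
  choose T hT using fun n : ℕ => hex (-(n : ℝ)) n (by linarith [Nat.cast_nonneg (α := ℝ) n])
  -- seminorm of a truncated integral
  have hTsem : ∀ (a b : ℝ) (hab : a ≤ b) (Ψ : 𝓢(E, F)), (∀ x, Ψ x = ∫ t in a..b, Φw t x) →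
      ∀ k n, SchwartzMap.seminorm ℝ k n Ψ ≤ ∫ t in a..b, |w t| * SchwartzMap.seminorm ℝ k n (Φ t) := by
    intro a b hab Ψ hΨ k n
    have h := SchwartzMap.seminorm_le_intervalIntegral_of_forall_apply_eq_integral hΦwc hab hΨ k n
    simpa only [hsem] using h
  -- the truncations are Cauchy
  have hcauchy : CauchySeq T := by
    rw [Literature.Analysis.FunctionSpaces.cauchySeq_schwartzMap_iff]
    intro k l ε hε
    -- tails of the integrable density
    set g : ℝ → ℝ := fun t => |w t| * SchwartzMap.seminorm ℝ k l (Φ t) with hg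
    have hgi : Integrable g := hint k l
    have hg0 : ∀ t, 0 ≤ g t := fun t => mul_nonneg (abs_nonneg _) (apply_nonneg _ _)
    have htail : Tendsto (fun n : ℕ => ∫ t in (-(n : ℝ))..n, g t) atTop (𝓝 (∫ t, g t)) :=
      intervalIntegral_tendsto_integral hgi (tendsto_neg_atTop_atBot.comp tendsto_natCast_atTop_atTop)
        tendsto_natCast_atTop_atTop
    have hc : CauchySeq fun n : ℕ => ∫ t in (-(n : ℝ))..n, g t := htail.cauchySeq
    rw [Metric.cauchySeq_iff] at hc
    obtain ⟨N₀, hN₀⟩ := hc ε hε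
    refine ⟨N₀, fun m hm n hn => ?_⟩
    -- reduce to `m ≤ n` by symmetry
    wlog hmn : m ≤ n generalizing m n
    · have h := this n hn m hm (le_of_not_ge hmn)
      rwa [← neg_sub, map_neg_eq_map] at h
    -- `T n - T m` is the sum of the integrals over `[m, n]` and `[-n, -m]`
    have hmn' : (m : ℝ) ≤ n := by exact_mod_cast hmn
    obtain ⟨P, hP⟩ := hex (m : ℝ) n hmn'
    obtain ⟨Q, hQ⟩ := hex (-(n : ℝ)) (-(m : ℝ)) (by linarith)
    have hdec : T n - T m = P + Q := by
      ext x
      simp only [sub_apply, add_apply, hT, hP, hQ]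
      have hi : ∀ a b : ℝ, IntervalIntegrable (fun t => Φw t x) volume a b := fun a b =>
        (SchwartzMap.continuous_apply_of_continuous hΦwc x).intervalIntegrable a b
      have h1 := intervalIntegral.integral_add_adjacent_intervals (hi (-(n : ℝ)) (-(m : ℝ)))
        (hi (-(m : ℝ)) m)
      have h2 := intervalIntegral.integral_add_adjacent_intervals (hi (-(n : ℝ)) (m : ℝ)) (hi (m : ℝ) n)
      rw [← h2, ← h1]
      abel
    rw [hdec]
    have hPQ : SchwartzMap.seminorm ℝ k l (P + Q) ≤
        (∫ t in (m : ℝ)..n, g t) + ∫ t in (-(n : ℝ))..(-(m : ℝ)), g t :=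
      (map_add_le_add _ _ _).trans (add_le_add (hTsem _ _ hmn' P hP k l) (hTsem _ _ (by linarith) Q hQ k l))
    -- the two tails are the difference of the symmetric truncations
    have hsplit : (∫ t in (-(n : ℝ))..n, g t) - ∫ t in (-(m : ℝ))..m, g t =
        (∫ t in (m : ℝ)..n, g t) + ∫ t in (-(n : ℝ))..(-(m : ℝ)), g t := by
      have hi : ∀ a b : ℝ, IntervalIntegrable g volume a b := fun a b => hgi.intervalIntegrable
      have h1 := intervalIntegral.integral_add_adjacent_intervals (hi (-(n : ℝ)) (-(m : ℝ))) (hi (-(m : ℝ)) m)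
      have h2 := intervalIntegral.integral_add_adjacent_intervals (hi (-(n : ℝ)) (m : ℝ)) (hi (m : ℝ) n)
      linarith
    have hdist := hN₀ n hn m hm
    rw [Real.dist_eq, hsplit] at hdist
    have hnn : 0 ≤ (∫ t in (m : ℝ)..n, g t) + ∫ t in (-(n : ℝ))..(-(m : ℝ)), g t :=
      add_nonneg (intervalIntegral.integral_nonneg hmn' fun t _ => hg0 t)
        (intervalIntegral.integral_nonneg (by linarith) fun t _ => hg0 t)
    rw [abs_of_nonneg hnn] at hdist
    exact hPQ.trans_lt hdist
  -- the limit
  obtain ⟨Ψ, hΨ⟩ := cauchySeq_tendsto_of_complete hcauchy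
  have heval : ∀ x, Tendsto (fun n => T n x) atTop (𝓝 (Ψ x)) := by
    intro x
    have hsub : Tendsto (fun n => T n - Ψ) atTop (𝓝 0) := by
      have h := hΨ.sub (tendsto_const_nhds (x := Ψ))
      rwa [sub_self] at h
    have hsm : Tendsto (fun n => SchwartzMap.seminorm ℝ 0 0 (T n - Ψ)) atTop (𝓝 0) := by
      have := ((schwartz_withSeminorms ℝ E F).continuous_seminorm (0, 0)).tendsto 0
      rw [map_zero] at this
      exact this.comp hsub
    rw [tendsto_iff_norm_sub_tendsto_zero]
    refine squeeze_zero (fun n => norm_nonneg _) (fun n => ?_) hsm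
    exact SchwartzMap.norm_le_seminorm ℝ (T n - Ψ) x
  have hlim : ∀ x, Tendsto (fun n => T n x) atTop (𝓝 (∫ t, w t • Φ t x)) := by
    intro x
    have hfi : Integrable fun t => w t • Φ t x := by
      obtain ⟨C, N, hC⟩ := hgrowth 0 0
      refine ((integrable_abs_mul_pow_of_decay hwc hw N).const_mul |C|).mono'
        ((hwc.smul (SchwartzMap.continuous_apply_of_continuous hΦ x)).aestronglyMeasurable)
        (Eventually.of_forall fun t => ?_)
      rw [norm_smul, Real.norm_eq_abs]
      calc |w t| * ‖Φ t x‖ ≤ |w t| * SchwartzMap.seminorm ℝ 0 0 (Φ t) :=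
            mul_le_mul_of_nonneg_left (SchwartzMap.norm_le_seminorm ℝ (Φ t) x) (abs_nonneg _)
        _ ≤ |w t| * (C * (1 + |t|) ^ N) := mul_le_mul_of_nonneg_left (hC t) (abs_nonneg _)
        _ ≤ |w t| * (|C| * (1 + |t|) ^ N) := by gcongr; exact le_abs_self C
        _ = |C| * (|w t| * (1 + |t|) ^ N) := by ring
    have h := intervalIntegral_tendsto_integral hfi
      (tendsto_neg_atTop_atBot.comp tendsto_natCast_atTop_atTop) tendsto_natCast_atTop_atTop
    refine h.congr fun n => ?_
    rw [hT n x]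
    simp only [Function.comp_apply, hΦw, smul_apply]
  refine ⟨Ψ, fun x => tendsto_nhds_unique (heval x) (hlim x), fun k n => ?_⟩
  -- the seminorm bound passes to the limit
  have hp : Tendsto (fun m => SchwartzMap.seminorm ℝ k n (T m)) atTop (𝓝 (SchwartzMap.seminorm ℝ k n Ψ)) :=
    (((schwartz_withSeminorms ℝ E F).continuous_seminorm (k, n)).tendsto Ψ).comp hΨ
  have hb : Tendsto (fun m : ℕ => ∫ t in (-(m : ℝ))..m, |w t| * SchwartzMap.seminorm ℝ k n (Φ t)) atTop
      (𝓝 (∫ t, |w t| * SchwartzMap.seminorm ℝ k n (Φ t))) :=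
    intervalIntegral_tendsto_integral (hint k n)
      (tendsto_neg_atTop_atBot.comp tendsto_natCast_atTop_atTop) tendsto_natCast_atTop_atTop
  exact le_of_tendsto_of_tendsto' hp hb fun m =>
    hTsem _ _ (by linarith [Nat.cast_nonneg (α := ℝ) m]) (T m) (hT m) k n

end Literature.Analysis.Distribution
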